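import Literature.AlgebraicGeometry.Motives.CechH1OfSheafCohomology
import Mathlib.Topology.Sheaves.SheafCondition.Sites
import Mathlib.AlgebraicGeometry.AffineScheme
import HarnessLib

/-!
# Morphisms of abelian sheaves on `Z ↪ X` from their values on the traces `i⁻¹U` of the affine opens of `X`

Topic `Literature/AlgebraicGeometry/Modules`. THEOREMS and definitions WITH BODY only (no named fact, no `sorry`, no
instance, no notation). Written for the literature-typing tranche LT-H1 «semiregularity consumers» (cell `pub-hsemireg`):
the last step of the assembly discharging `Deformation.Hartshorne2010_localHilbertFunctor_isSmooth_of_subsingleton_normalH1`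
identifies two abelian sheaves on a closed subscheme `Z ⊆ X` (the tangent sheaf of the local Hilbert functor and the normal
sheaf `𝒩_{Z/X}`) from additive identifications of their sections over the opens `i⁻¹U`, `U ⊆ X` AFFINE, natural along
inclusions `U' ≤ U` of affine opens — «the construction is compatible with localization, and the correspondence is
natural» ([Hartshorne2010, §2 p. 13]) — and then transports `H¹`.

The underlying general statement is the extension of morphisms of sheaves from a basis of the topology
([StacksProject, Tag 009U]; EGA 0_I (3.2.5); Mathlib `TopCat.Sheaf.restrictHomEquivHom`, `extend_hom_app`, `hom_ext`,
`isIso_iff_isIso_basis`, for the induced subcategory of a family `B : ι → Opens Z` whose range is a basis). What this file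
adds is the shape the charts deliver:

* `isBasis_range_preimage_affineOpens` — for `i : Z ⟶ X` inducing the topology of `Z` (e.g. a closed immersion) the
  traces `i⁻¹U` of the affine opens `U ⊆ X` form a basis of `Z`;
* `AffineTraceHomData i F G` — a hypothesis STRUCTURE: maps `app U : F(i⁻¹U) ⟶ G(i⁻¹U)` for `U : X.affineOpens`,
  natural ONLY along inclusions `U' ≤ U` of affine opens of `X`;
* `AffineTraceHomData.naturality_of_preimage_le` — such data is automatically natural along EVERY inclusion `i⁻¹U' ≤ i⁻¹U`
  (cover `i⁻¹U'` by traces of affine opens `U'' ⊆ U ∩ U'`; `G` is separated) — no separatedness of `X` is needed;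
* `AffineTraceHomData.extend` — the unique morphism of sheaves `F ⟶ G` with `extend.hom.app (op (i⁻¹U)) = app U`
  (`extend_app`, `extend_unique`); `isIso_extend` when every `app U` is bijective; `AffineTraceHomData.iso`;
* `sheafAddEquivH` ∕ `subsingleton_H_iff_of_iso` — an isomorphism of abelian sheaves induces `Hⁿ(F) ≃+ Hⁿ(G)`
  (Mathlib `Sheaf.H.map`), so `Hⁿ(F) = 0 ↔ Hⁿ(G) = 0`; `AffineTraceHomData.subsingleton_H_iff`.

## What is NOT here

No scheme structure is used beyond «affine opens form a basis of `X`»; no modules (plain abelian sheaves, the currency of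
`Deformation/PseudotorsorSheafGluing.lean` and of Mathlib's `Sheaf.H`); no statement about any specific sheaf.

## References

* [StacksProject] The Stacks Project, Tag 009U (sheaves and morphisms of sheaves on a basis), Tag 01QN (closed immersions).
* [Hartshorne2010] R. Hartshorne, *Deformation Theory*, GTM 257 (2010), §2 p. 13 («compatible with localization»).
* [Hartshorne1977] R. Hartshorne, *Algebraic Geometry*, GTM 52 (1977), II Prop. 1.1, II Ex. 1.15, III §2 (cohomology functors).
-/

noncomputable section

open CategoryTheory AlgebraicGeometry Opposite TopologicalSpace Topology

universe u

namespace Literature.AlgebraicGeometry.Modules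

/-! ### The traces of the affine opens of `X` on `Z` -/

section Basis

variable {X Z : Scheme.{u}} (i : Z ⟶ X)

/-- The trace `i⁻¹U ⊆ Z` of an affine open `U ⊆ X` (the family indexing the charts). [cite: StacksProject, Tag 009U] -/
abbrev preimageAffineOpen (U : X.affineOpens) : Z.Opens := i ⁻¹ᵁ (U : X.Opens)

/-- Every point of an open `V ⊆ Z` with `i⁻¹U ⊆ V`-type neighbourhoods: if `i` induces the topology of `Z`, then for
`z ∈ V` there is an affine open `U ⊆ X` with `z ∈ i⁻¹U ⊆ V`. [cite: StacksProject, Tag 01QN] -/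
theorem exists_mem_preimage_affineOpen_le (hi : IsInducing i.base) {V : Z.Opens} {z : ↥Z} (hz : z ∈ V) :
    ∃ U : X.affineOpens, z ∈ preimageAffineOpen i U ∧ preimageAffineOpen i U ≤ V := by
  obtain ⟨W, hW, hWV⟩ := hi.isOpen_iff.mp V.2
  have hzW : i.base z ∈ (⟨W, hW⟩ : X.Opens) := by
    change z ∈ i.base ⁻¹' W
    rw [hWV]
    exact hz
  obtain ⟨U, hU, hzU, hUW⟩ := Opens.isBasis_iff_nbhd.mp X.isBasis_affineOpens hzW
  refine ⟨⟨U, hU⟩, hzU, fun z' hz' => ?_⟩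
  have hz'W : z' ∈ i.base ⁻¹' W := hUW hz'
  rw [hWV] at hz'W
  exact hz'W

/-- **The traces `i⁻¹U` of the affine opens `U ⊆ X` form a basis of `Z`** whenever `i : Z ⟶ X` induces the topology of
`Z` (closed immersions, immersions). [cite: StacksProject, Tag 01QN] [cite: StacksProject, Tag 009U] -/
theorem isBasis_range_preimageAffineOpen (hi : IsInducing i.base) :
    Opens.IsBasis (Set.range (preimageAffineOpen i)) := by
  refine Opens.isBasis_iff_nbhd.mpr fun {V z} hz => ?_
  obtain ⟨U, hzU, hUV⟩ := exists_mem_preimage_affineOpen_le i hi hz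
  exact ⟨preimageAffineOpen i U, ⟨U, rfl⟩, hzU, hUV⟩

/-- For `z ∈ i⁻¹U ∩ i⁻¹U'` there is an affine open `U'' ⊆ U ∩ U'` with `z ∈ i⁻¹U''` (affine opens are a basis of `X`; no
separatedness needed). [cite: StacksProject, Tag 009U] -/
theorem exists_affineOpen_le_inf (U U' : X.affineOpens) {z : ↥Z} (hz : z ∈ preimageAffineOpen i U)
    (hz' : z ∈ preimageAffineOpen i U') : ∃ U'' : X.affineOpens, U'' ≤ U ∧ U'' ≤ U' ∧ z ∈ preimageAffineOpen i U'' := by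
  have hzW : i.base z ∈ (U : X.Opens) ⊓ (U' : X.Opens) := ⟨hz, hz'⟩
  obtain ⟨W, hW, hzW', hle⟩ := Opens.isBasis_iff_nbhd.mp X.isBasis_affineOpens hzW
  exact ⟨⟨W, hW⟩, fun x hx => (hle hx).1, fun x hx => (hle hx).2, hzW'⟩

end Basis

/-! ### Morphisms given on the traces of affine opens, natural along affine inclusions -/

section Extend

variable {X Z : Scheme.{u}} (i : Z ⟶ X) (F G : Sheaf (Opens.grothendieckTopology Z) AddCommGrpCat.{u})

/-- **Chart data for a morphism of abelian sheaves on `Z`**: a map `F(i⁻¹U) → G(i⁻¹U)` for every AFFINE open `U ⊆ X`,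
natural along the inclusions `U' ≤ U` of affine opens («the construction is compatible with localization»). A
hypothesis structure (data + the one axiom its consumers can verify chart by chart).
[cite: Hartshorne2010, §2 p. 13] [cite: StacksProject, Tag 009U] -/
structure AffineTraceHomData where
  /-- the map on sections over the trace of an affine open -/
  app : ∀ U : X.affineOpens, F.obj.obj (op (preimageAffineOpen i U)) ⟶ G.obj.obj (op (preimageAffineOpen i U))
  /-- naturality along inclusions of AFFINE opens of `X` -/
  naturality : ∀ {U U' : X.affineOpens} (h : U' ≤ U),
    F.obj.map (homOfLE (Scheme.Hom.preimage_mono i h)).op ≫ app U' =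
      app U ≫ G.obj.map (homOfLE (Scheme.Hom.preimage_mono i h)).op

variable {i F G} (D : AffineTraceHomData i F G)

namespace AffineTraceHomData

/-- Naturality on elements, along an inclusion of affine opens. [cite: StacksProject, Tag 009U] -/
theorem app_map_of_le {U U' : X.affineOpens} (h : U' ≤ U) (s : F.obj.obj (op (preimageAffineOpen i U))) :
    D.app U' (F.obj.map (homOfLE (Scheme.Hom.preimage_mono i h)).op s) =
      G.obj.map (homOfLE (Scheme.Hom.preimage_mono i h)).op (D.app U s) := by
  rw [← ConcreteCategory.comp_apply, D.naturality h, ConcreteCategory.comp_apply]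

/-- **Chart data is natural along EVERY inclusion `i⁻¹U' ≤ i⁻¹U` of traces** (not only those coming from `U' ≤ U`):
both sides agree after restriction to the traces `i⁻¹U''` of the affine opens `U'' ⊆ U ∩ U'`, which cover `i⁻¹U'`, and
`G` is a sheaf. [cite: StacksProject, Tag 009U] -/
theorem naturality_of_preimage_le {U U' : X.affineOpens} (hle : preimageAffineOpen i U' ≤ preimageAffineOpen i U) :
    F.obj.map (homOfLE hle).op ≫ D.app U' = D.app U ≫ G.obj.map (homOfLE hle).op := by
  ext s
  rw [ConcreteCategory.comp_apply, ConcreteCategory.comp_apply]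
  -- the cover of `i⁻¹U'` by the traces of the affine opens inside `U ∩ U'`
  let J := {U'' : X.affineOpens // U'' ≤ U ∧ U'' ≤ U'}
  let C : J → Z.Opens := fun j => preimageAffineOpen i j.1
  have hCle : ∀ j : J, C j ≤ preimageAffineOpen i U' := fun j => Scheme.Hom.preimage_mono i j.2.2
  have hcov : preimageAffineOpen i U' ≤ iSup C := by
    intro z hz
    obtain ⟨U'', h1, h2, hz''⟩ := exists_affineOpen_le_inf i U U' (hle hz) hz
    exact Opens.mem_iSup.mpr ⟨⟨U'', h1, h2⟩, hz''⟩
  refine TopCat.Sheaf.eq_of_locally_eq' (C := AddCommGrpCat.{u}) (X := Z) G C (preimageAffineOpen i U')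
    (fun j => homOfLE (hCle j)) hcov _ _ fun j => ?_
  -- both sides restrict to `D.app U'' (s|)` on the trace of `U'' ⊆ U ∩ U'`
  have hF : F.obj.map (homOfLE (Scheme.Hom.preimage_mono i j.2.2)).op (F.obj.map (homOfLE hle).op s) =
      F.obj.map (homOfLE (Scheme.Hom.preimage_mono i j.2.1)).op s := by
    rw [← ConcreteCategory.comp_apply, ← F.obj.map_comp, ← op_comp, homOfLE_comp]
  have hG : G.obj.map (homOfLE (hCle j)).op (G.obj.map (homOfLE hle).op (D.app U s)) =
      G.obj.map (homOfLE (Scheme.Hom.preimage_mono i j.2.1)).op (D.app U s) := by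
    rw [← ConcreteCategory.comp_apply, ← G.obj.map_comp, ← op_comp, homOfLE_comp]
  calc G.obj.map (homOfLE (hCle j)).op (D.app U' (F.obj.map (homOfLE hle).op s))
      = D.app j.1 (F.obj.map (homOfLE (Scheme.Hom.preimage_mono i j.2.2)).op (F.obj.map (homOfLE hle).op s)) :=
        (D.app_map_of_le j.2.2 _).symm
    _ = D.app j.1 (F.obj.map (homOfLE (Scheme.Hom.preimage_mono i j.2.1)).op s) := by rw [hF]
    _ = G.obj.map (homOfLE (Scheme.Hom.preimage_mono i j.2.1)).op (D.app U s) := D.app_map_of_le j.2.1 s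
    _ = G.obj.map (homOfLE (hCle j)).op (G.obj.map (homOfLE hle).op (D.app U s)) := hG.symm

/-- The chart data as a natural transformation between the restrictions of `F` and `G` to the induced category of the
family of traces (Mathlib `inducedFunctor`). Definition with body. [cite: StacksProject, Tag 009U] -/
def restricted : (inducedFunctor (preimageAffineOpen i)).op ⋙ F.obj ⟶ (inducedFunctor (preimageAffineOpen i)).op ⋙ G.obj where
  app U := D.app U.unop
  naturality U U' f := by
    have h := D.naturality_of_preimage_le f.unop.hom.le
    have e : homOfLE f.unop.hom.le = f.unop.hom := Subsingleton.elim _ _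
    rw [e] at h
    exact h

/-- Unfolding `restricted`. [cite: StacksProject, Tag 009U] -/
@[simp]
theorem restricted_app (U : (X.affineOpens)ᵒᵖ) : D.restricted.app U = D.app U.unop := rfl

variable (hi : IsInducing i.base)

/-- **The morphism of sheaves `F ⟶ G` extending the chart data** (Mathlib `TopCat.Sheaf.restrictHomEquivHom` on the basis
of traces). Definition with body. [cite: StacksProject, Tag 009U] -/
def extend : F ⟶ G :=
  ObjectProperty.homMk
    (TopCat.Sheaf.restrictHomEquivHom (C := AddCommGrpCat.{u}) (X := Z) F.obj G
      (isBasis_range_preimageAffineOpen i hi) D.restricted)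

/-- **The extension restricts to the given maps on the traces of affine opens.** [cite: StacksProject, Tag 009U] -/
@[simp]
theorem extend_app (U : X.affineOpens) : (D.extend hi).hom.app (op (preimageAffineOpen i U)) = D.app U := by
  rw [extend, ObjectProperty.homMk_hom]
  exact TopCat.Sheaf.extend_hom_app (C := AddCommGrpCat.{u}) (X := Z) F.obj G
    (isBasis_range_preimageAffineOpen i hi) D.restricted U

/-- The extension on elements. [cite: StacksProject, Tag 009U] -/
theorem extend_app_apply (U : X.affineOpens) (s : F.obj.obj (op (preimageAffineOpen i U))) :
    (D.extend hi).hom.app (op (preimageAffineOpen i U)) s = D.app U s := by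
  rw [extend_app]

/-- **Uniqueness**: a morphism of sheaves agreeing with the chart data on the traces of affine opens IS the extension.
[cite: StacksProject, Tag 009U] -/
theorem extend_unique {φ : F ⟶ G} (hφ : ∀ U : X.affineOpens, φ.hom.app (op (preimageAffineOpen i U)) = D.app U) :
    φ = D.extend hi := by
  apply ObjectProperty.hom_ext
  exact TopCat.Sheaf.hom_ext (C := AddCommGrpCat.{u}) (X := Z) F.obj G (isBasis_range_preimageAffineOpen i hi)
    fun U => by rw [hφ U, extend_app]

include hi in
/-- Two morphisms of sheaves on `Z` agreeing on the traces of the affine opens of `X` are equal.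
[cite: StacksProject, Tag 009U] -/
theorem hom_ext_of_preimageAffineOpen {φ ψ : F ⟶ G}
    (h : ∀ U : X.affineOpens, φ.hom.app (op (preimageAffineOpen i U)) = ψ.hom.app (op (preimageAffineOpen i U))) :
    φ = ψ := by
  apply ObjectProperty.hom_ext
  exact TopCat.Sheaf.hom_ext (C := AddCommGrpCat.{u}) (X := Z) F.obj G (isBasis_range_preimageAffineOpen i hi) h

/-- **If every chart map is bijective, the extension is an isomorphism of sheaves** (Mathlib
`TopCat.Sheaf.isIso_iff_isIso_basis`). [cite: StacksProject, Tag 009U] -/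
theorem isIso_extend (hD : ∀ U : X.affineOpens, Function.Bijective (D.app U)) : IsIso (D.extend hi) := by
  refine TopCat.Sheaf.isIso_iff_isIso_basis (C := AddCommGrpCat.{u}) (X := Z)
    (isBasis_range_preimageAffineOpen i hi) fun U => ?_
  rw [extend_app]
  exact (ConcreteCategory.isIso_iff_bijective (D.app U)).mpr (hD U)

/-- **The isomorphism of abelian sheaves `F ≅ G` glued from bijective chart data.** Definition with body.
[cite: StacksProject, Tag 009U] -/
def iso (hD : ∀ U : X.affineOpens, Function.Bijective (D.app U)) : F ≅ G :=
  haveI := D.isIso_extend hi hD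
  asIso (D.extend hi)

/-- Unfolding `iso`. [cite: StacksProject, Tag 009U] -/
@[simp]
theorem iso_hom (hD : ∀ U : X.affineOpens, Function.Bijective (D.app U)) : (D.iso hi hD).hom = D.extend hi := rfl

end AffineTraceHomData

end Extend

/-! ### Cohomology along an isomorphism of abelian sheaves -/

section Cohomology

universe w' w v' u'

variable {C : Type u'} [Category.{v'} C] {J : GrothendieckTopology C} [HasSheafify J AddCommGrpCat.{w}]
  [HasExt.{w'} (Sheaf J AddCommGrpCat.{w})]

/-- **An isomorphism of abelian sheaves induces `Hⁿ(F) ≃+ Hⁿ(G)`** (functoriality of Mathlib's `Sheaf.H`).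
Definition with body. [cite: Hartshorne1977, III §2 (cohomology functors), p. 207] -/
def sheafAddEquivH {F G : Sheaf J AddCommGrpCat.{w}} (e : F ≅ G) (n : ℕ) : Sheaf.H F n ≃+ Sheaf.H G n where
  toFun := Sheaf.H.map e.hom n
  invFun := Sheaf.H.map e.inv n
  left_inv x := by rw [← Sheaf.H.map_comp_apply, e.hom_inv_id, Sheaf.H.map_id_apply]
  right_inv x := by rw [← Sheaf.H.map_comp_apply, e.inv_hom_id, Sheaf.H.map_id_apply]
  map_add' x y := map_add _ x y

/-- Unfolding `sheafAddEquivH`. [cite: Hartshorne1977, III §2, p. 207] -/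
@[simp]
theorem sheafAddEquivH_apply {F G : Sheaf J AddCommGrpCat.{w}} (e : F ≅ G) (n : ℕ) (x : Sheaf.H F n) :
    sheafAddEquivH e n x = Sheaf.H.map e.hom n x := rfl

/-- **`Hⁿ(F) = 0 ↔ Hⁿ(G) = 0` for isomorphic abelian sheaves.** [cite: Hartshorne1977, III §2, p. 207] -/
theorem subsingleton_H_iff_of_iso {F G : Sheaf J AddCommGrpCat.{w}} (e : F ≅ G) (n : ℕ) :
    Subsingleton (Sheaf.H F n) ↔ Subsingleton (Sheaf.H G n) :=
  ⟨fun _ => (sheafAddEquivH e n).symm.subsingleton, fun _ => (sheafAddEquivH e n).subsingleton⟩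

end Cohomology

section ChartsCohomology

variable {X Z : Scheme.{u}} {i : Z ⟶ X} {F G : Sheaf (Opens.grothendieckTopology Z) AddCommGrpCat.{u}}
  (D : AffineTraceHomData i F G) (hi : IsInducing i.base)

include hi in
/-- **Bijective chart data natural along affine inclusions ⇒ `Hⁿ(Z, F) = 0 ↔ Hⁿ(Z, G) = 0`** — the form consumed by the
discharge of [Hartshorne2010, Cor. 6.3] (`F` = tangent sheaf of the local Hilbert functor, `G` = `𝒩_{Z/X}`, `n = 1`).
[cite: StacksProject, Tag 009U] [cite: Hartshorne2010, §2 p. 13 and Cor. 6.3, p. 50] -/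
theorem AffineTraceHomData.subsingleton_H_iff (hD : ∀ U : X.affineOpens, Function.Bijective (D.app U)) (n : ℕ) :
    Subsingleton (F.H n) ↔ Subsingleton (G.H n) :=
  subsingleton_H_iff_of_iso (D.iso hi hD) n

end ChartsCohomology

end Literature.AlgebraicGeometry.Modules

end
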